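import Literature.Probability.LatticeModels.ThreeUpSetsExactlyOneBound
import HarnessLib

/-!
# Williams (2025), §4: Kahn's `4/9` conjecture on three up-sets is false — the counterexample in `Q_21`
# pulled back from the weighted cube `Q_7(3/8)`

CITATION HEADER.  Source: K. Williams, *A Correlation Inequality on Three Functions*, arXiv:2502.14857v2 (2025)
[WilliamsKK2025], §4 "A counterexample for Conjecture 4" (pp. 3–4), read from the materialised arXiv text
(`paper:arxiv-2502.14857`, p0003–p0004).  The conjecture refuted (p. 2, verbatim): "**Conjecture 4 (Kahn).** If
`|X| = |Y| = |Z|`, then `|S_1|/2^n ≤ 4/9`." — here `X, Y, Z ⊂ Q_n` are upward closed set systems in the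
`n`-dimensional hypercube and `S_1 = (X ∩ Y^c ∩ Z^c) ⊔ (X^c ∩ Y ∩ Z^c) ⊔ (X^c ∩ Y^c ∩ Z)` is the set of points lying in
exactly one of them (the tree's `Williams2025.exactlyOne`, file `ThreeUpSetsExactlyOneBound.lean`, whose
`TODO(general form)` about §4 this file discharges); "This conjecture is due to Jeff Kahn [3]. We provide a
counterexample in `n = 21` dimensions, where the density of `S_1` exceeds `0.447`."

§4 verbatim (pp. 3–4): "Like Sahi [4], we consider the weighted hypercube `Q_n(p)`, which is the measure space of `n`
independent Bernoulli bits `B(p)`. That means that a set of `k` elements in `Q_n` has measure `p^k(1 − p)^{n−k}`. …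
Thus, we generate a counterexample in `Q_21` of density `≈ 0.447` from an approximate counterexample in `Q_7(3/8)`.
Consider `X` and `Y` to be the sets containing `1` and `2`, respectively, in `Q_n(p)`. Let `Z` contain the sets of
size at least `l + 1`, as well as the sets of size `l` that are not in `X` or `Y`. … For example, in the case of
`n = 7` and `l = 3`, `q(p) > 0.447` if `p = 3/8`. There, the measure of `Z` is only `≈ 0.323`, but including all the
supersets of `{1, 2}` from `X ∩ Y` boosts the measure of `Z` up to `≈ 0.377 > 3/8`.  A measure-preserving map
`f : Q_21 → Q_7(3/8)` arises from the upward closed `I = {{1, 2}, {1, 3}, {1, 2, 3}} ⊂ Q_3`. Viewing `Q_21 ≅ (Q_3)^7`,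
we map `I` to `1` and `I^c` to `0` at every coordinate. Clearly, the preimages of `X, Y`, and `Z` are upward
closed.  In `Q_21`, the upward closed system `f^{-1}(Z)` can be modified by including sets that map to a superset of
`{1, 2}`. Including only a maximal set in each step, the size of the set system can be incremented until it equals
`3/8` exactly. Meanwhile, the measure of sets contained in exactly one of our three set systems is `> 0.447 > 4/9`."

What is here (everything PROVED; no named fact; the only `def`s are the printed finite objects and the block
presentation `Q_21 ≅ (Q_3)^7`).  Indices are `0`-based (`1, 2 ↦ 0, 1`).
* `Williams2025.exists_isUpperSet_between` — the abstract step "including only a maximal set in each step": between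
  two finite up-sets `U ⊆ C` of a partial order there is an up-set of every intermediate cardinality.
* The block presentation `Williams2025.Cube21 := Fin 7 → Finset (Fin 3)` of `Q_21 ≅ (Q_3)^7` with its order
  isomorphism `Williams2025.cubeIso : Cube21 ≃o Finset (Fin 21)` (coordinate `(i, j) ↦ 3i + j`, `finProdFinEquiv`);
  the printed `I ⊂ Q_3` (`Williams2025.I3`), the block map `f` (`Williams2025.blockMap`, monotone), and the FIBRE
  COUNT `Williams2025.card_pre`: `#f⁻¹(A) = Σ_{S ∈ A} 3^{#S}·5^{7−#S}` (`= 8^7 · μ_{Q_7(3/8)}(A)`, i.e. `f` pushes the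
  uniform measure of `Q_21` to the `3/8`-Bernoulli measure of `Q_7` — "a measure-preserving map").
* The printed systems `X7, Y7, Z7 ⊂ Q_7` (`n = 7`, `l = 3`) with the exact weighted counts behind the printed decimals
  (`decide`): `8^7·μ(X) = 8^7·μ(Y) = 786432 = (3/8)·8^7`; `8^7·μ(Z) = 678402` (`≈ 0.323`); with the supersets of
  `{1,2}` added `790902` (`≈ 0.377 > 3/8`); `8^7·μ(S_1) = 937950` (`q(3/8) = 0.44725 > 0.447 > 4/9`).
* **`Williams2025.conjecture4_false_cube21`** / **`williams2025_conjecture4_false`** — in `Q_21` (block form, resp.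
  `Finset (Fin 21)`): upward closed `X, Y, Z` with `|X| = |Y| = |Z| = 786432 = (3/8)·2^21` and
  `|S_1| = 937950 > (4/9)·2^21`; **`kahn_conjecture4_false`** — the negation of Conjecture 4 as displayed.
-- TODO(general form): the closed formula for `q(p)` for general `n, l` and the remark `q(1/3) = 4/9` (p. 4) are not
-- formalised; only the printed instance `n = 7, l = 3, p = 3/8` is.

## References
* K. Williams, *A Correlation Inequality on Three Functions*, arXiv:2502.14857 (2025), Conjecture 4 (p. 2) and §4
  (pp. 3–4). [WilliamsKK2025]
* J. Kahn, *A note on positive association*, arXiv:2210.08653 (2022) (the attribution "[3]" of the conjecture is to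
  B. Narayanan, J. Kahn, S. Spirkl, personal communication, per Williams' reference list). [Kahn2022]
-/

namespace Literature.Probability.LatticeModels

namespace Williams2025

open Finset

/-! ### "Including only a maximal set in each step" -/

/-- Between two finite upward closed families `U ⊆ C` of a partial order there is an upward closed family of every
intermediate cardinality: add, one at a time, a maximal element of `C ∖ V` ("Including only a maximal set in each
step, the size of the set system can be incremented until it equals `3/8` exactly").
[cite: WilliamsKK2025, §4 (p. 4)] -/
theorem exists_isUpperSet_between {α : Type*} [PartialOrder α] [DecidableEq α] {U C : Finset α}
    (hU : IsUpperSet (U : Set α)) (hC : IsUpperSet (C : Set α)) (hUC : U ⊆ C) {m : ℕ}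
    (hUm : U.card ≤ m) (hmC : m ≤ C.card) :
    ∃ V : Finset α, IsUpperSet (V : Set α) ∧ U ⊆ V ∧ V ⊆ C ∧ V.card = m := by
  induction m with
  | zero => exact ⟨U, hU, Subset.rfl, hUC, by omega⟩
  | succ m ih =>
    by_cases h : U.card = m + 1
    · exact ⟨U, hU, Subset.rfl, hUC, h⟩
    · obtain ⟨V, hV, hUV, hVC, hVm⟩ := ih (by omega) (by omega)
      have hne : (C \ V).Nonempty := by
        rw [sdiff_nonempty]
        intro hCV
        have := card_le_card hCV
        omega
      obtain ⟨T, hT⟩ := exists_maximal hne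
      have hTC : T ∈ C := (mem_sdiff.1 hT.1).1
      have hTV : T ∉ V := (mem_sdiff.1 hT.1).2
      refine ⟨insert T V, ?_, hUV.trans (subset_insert _ _), insert_subset hTC hVC,
        by rw [card_insert_of_notMem hTV, hVm]⟩
      intro a b hab ha
      rw [coe_insert, Set.mem_insert_iff] at ha ⊢
      rcases ha with rfl | ha
      · by_cases hb : b ∈ V
        · exact Or.inr hb
        · exact Or.inl (le_antisymm (hT.2 (mem_sdiff.2 ⟨hC hab hTC, hb⟩) hab) hab)
      · exact Or.inr (hV hab ha)

/-- A variant of `exactlyOne` stability: enlarging `Z` inside `Z ∪ (X ∩ Y)` does not change the "exactly one" set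
(the added points lie in at least two of the systems before and after). [cite: WilliamsKK2025, §4 (p. 4)] -/
theorem exactlyOne_eq_of_subset {α : Type*} [DecidableEq α] {X Y Z Z' : Finset α} (h1 : Z ⊆ Z')
    (h2 : Z' ⊆ Z ∪ (X ∩ Y)) : exactlyOne X Y Z' = exactlyOne X Y Z := by
  ext x
  have a : x ∈ Z → x ∈ Z' := fun h => h1 h
  have b : x ∈ Z' → x ∈ Z ∨ (x ∈ X ∧ x ∈ Y) := fun h => by simpa [mem_union, mem_inter] using h2 h
  simp only [exactlyOne, mem_union, mem_sdiff, not_or]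
  tauto

/-! ### The block presentation `Q_21 ≅ (Q_3)^7` and the measure-preserving map `f : Q_21 → Q_7(3/8)` -/

/-- `Q_21` presented as `(Q_3)^7`: a point is a `7`-tuple of subsets of a `3`-set, ordered coordinatewise by
inclusion ("Viewing `Q_21 ≅ (Q_3)^7`"). [cite: WilliamsKK2025, §4 (p. 4)] -/
abbrev Cube21 : Type := Fin 7 → Finset (Fin 3)

/-- The printed up-set `I = {{1,2},{1,3},{1,2,3}} ⊂ Q_3` (`0`-indexed), of uniform measure `3/8`.
[cite: WilliamsKK2025, §4 (p. 4)] -/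
def I3 : Finset (Finset (Fin 3)) := {{0, 1}, {0, 2}, {0, 1, 2}}

/-- `I` is upward closed. [cite: WilliamsKK2025, §4 (p. 4)] -/
theorem isUpperSet_I3 : IsUpperSet (I3 : Set (Finset (Fin 3))) := by
  intro a b hab ha
  rw [mem_coe] at ha ⊢
  have key : ∀ a ∈ (univ : Finset (Finset (Fin 3))), ∀ b ∈ (univ : Finset (Finset (Fin 3))),
      a ⊆ b → a ∈ I3 → b ∈ I3 := by decide
  exact key a (mem_univ a) b (mem_univ b) hab ha

/-- `#I = 3` and `#I^c = 5` (so `I` has measure `3/8` in `Q_3`). [cite: WilliamsKK2025, §4 (p. 4)] -/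
theorem card_I3 : #(univ.filter fun b : Finset (Fin 3) => b ∈ I3) = 3 ∧
    #(univ.filter fun b : Finset (Fin 3) => b ∉ I3) = 5 := by decide

/-- The block map `f : Q_21 → Q_7`, "we map `I` to `1` and `I^c` to `0` at every coordinate".
[cite: WilliamsKK2025, §4 (p. 4)] -/
def blockMap (x : Cube21) : Finset (Fin 7) := univ.filter fun i => x i ∈ I3

/-- `f` is monotone ("Clearly, the preimages of `X, Y`, and `Z` are upward closed"). [cite: WilliamsKK2025, §4 (p. 4)] -/
theorem blockMap_mono : Monotone blockMap := by
  intro x y hxy i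
  simp only [blockMap, mem_filter, mem_univ, true_and]
  exact fun hi => isUpperSet_I3 (hxy i) hi

/-- The weighted count `8^7 · μ_{Q_7(3/8)}(A) = Σ_{S ∈ A} 3^{#S} 5^{7−#S}` of a family `A ⊂ Q_7` ("a set of `k`
elements in `Q_n` has measure `p^k(1−p)^{n−k}`", `p = 3/8`, `n = 7`), written as a product over coordinates.
[cite: WilliamsKK2025, §4 (p. 3)] -/
def wt (A : Finset (Finset (Fin 7))) : ℕ := ∑ S ∈ A, ∏ i : Fin 7, if i ∈ S then 3 else 5

/-- The coordinate product is the printed weight numerator: `∏_i [i ∈ S ? 3 : 5] = 3^{#S}·5^{7−#S}`.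
[cite: WilliamsKK2025, §4 (p. 3)] -/
theorem prod_ite_mem_eq (S : Finset (Fin 7)) :
    (∏ i : Fin 7, if i ∈ S then 3 else 5 : ℕ) = 3 ^ #S * 5 ^ (7 - #S) := by
  rw [prod_ite, prod_const, prod_const]
  congr 2
  · rw [filter_mem_eq_inter, univ_inter]
  · rw [filter_not, filter_mem_eq_inter, univ_inter, card_univ_sdiff, Fintype.card_fin]

/-- `wt` IS `8^7` times the measure of `Q_7(3/8)`: "a set of `k` elements in `Q_n` has measure `p^k(1 − p)^{n−k}`"
with `n = 7`, `p = 3/8`, i.e. `wt A / 8^7 = Σ_{S ∈ A} (3/8)^{#S} (5/8)^{7−#S}`. [cite: WilliamsKK2025, §4 (p. 3)] -/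
theorem wt_div_eq_measure (A : Finset (Finset (Fin 7))) :
    (wt A : ℚ) / 8 ^ 7 = ∑ S ∈ A, (3 / 8 : ℚ) ^ #S * (5 / 8 : ℚ) ^ (7 - #S) := by
  rw [wt, Nat.cast_sum, sum_div]
  refine sum_congr rfl fun S _ => ?_
  have hS : #S ≤ 7 := by simpa using S.card_le_univ
  rw [prod_ite_mem_eq, Nat.cast_mul, Nat.cast_pow, Nat.cast_pow, div_pow, div_pow]
  have h8 : (8 : ℚ) ^ 7 = 8 ^ #S * 8 ^ (7 - #S) := by rw [← pow_add, Nat.add_sub_cancel' hS]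
  rw [h8]
  field_simp
  push_cast
  ring

/-- The preimage `f^{-1}(A) ⊂ Q_21` of a family `A ⊂ Q_7`. [cite: WilliamsKK2025, §4 (p. 4)] -/
def pre (A : Finset (Finset (Fin 7))) : Finset Cube21 := univ.filter fun x => blockMap x ∈ A

/-- Preimages of upward closed families are upward closed. [cite: WilliamsKK2025, §4 (p. 4)] -/
theorem isUpperSet_pre {A : Finset (Finset (Fin 7))} (hA : IsUpperSet (A : Set (Finset (Fin 7)))) :
    IsUpperSet (pre A : Set Cube21) := by
  intro x y hxy hx
  rw [mem_coe] at hx ⊢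
  simp only [pre, mem_filter, mem_univ, true_and] at hx ⊢
  exact hA (blockMap_mono hxy) hx

/-- `f^{-1}` is monotone in the family. [cite: WilliamsKK2025, §4 (p. 4)] -/
theorem pre_mono {A B : Finset (Finset (Fin 7))} (h : A ⊆ B) : pre A ⊆ pre B := by
  intro x hx
  simp only [pre, mem_filter, mem_univ, true_and] at hx ⊢
  exact h hx

/-- FIBRE COUNT: the fibre of `f` over `S ⊂ [7]` has `3^{#S}·5^{7−#S}` points (`#I = 3`, `#I^c = 5` per coordinate).
[cite: WilliamsKK2025, §4 (p. 4)] -/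
theorem card_fibre (S : Finset (Fin 7)) :
    #(univ.filter fun x : Cube21 => blockMap x = S) = ∏ i : Fin 7, if i ∈ S then 3 else 5 := by
  rw [← Fintype.card_subtype]
  have e : {x : Cube21 // blockMap x = S} ≃ ((i : Fin 7) → {b : Finset (Fin 3) // b ∈ I3 ↔ i ∈ S}) :=
    (Equiv.subtypeEquivRight (fun x => by simp [blockMap, Finset.ext_iff])).trans Equiv.subtypePiEquivPi
  rw [Fintype.card_congr e, Fintype.card_pi]
  refine prod_congr rfl fun i _ => ?_
  rw [Fintype.card_subtype]
  by_cases hi : i ∈ S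
  · rw [if_pos hi, filter_congr (q := fun b => b ∈ I3) (fun b _ => by simp [hi])]
    exact card_I3.1
  · rw [if_neg hi, filter_congr (q := fun b => b ∉ I3) (fun b _ => by simp [hi])]
    exact card_I3.2

/-- `f` IS MEASURE-PRESERVING from uniform `Q_21` to `Q_7(3/8)`: `#f^{-1}(A) = 8^7 · μ_{3/8}(A)` for every family
`A ⊂ Q_7`. [cite: WilliamsKK2025, §4 (p. 4)] -/
theorem card_pre (A : Finset (Finset (Fin 7))) : #(pre A) = wt A := by
  unfold pre wt
  rw [card_eq_sum_card_fiberwise (f := blockMap) (t := A) (fun x hx => by simpa using hx)]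
  refine sum_congr rfl fun S hS => ?_
  rw [← card_fibre S, filter_filter]
  congr 1
  exact filter_congr fun x _ => ⟨fun h => h.2, fun h => ⟨h ▸ hS, h⟩⟩

/-- `exactlyOne` commutes with preimages. [cite: WilliamsKK2025, §4 (p. 4)] -/
theorem exactlyOne_pre (A B C : Finset (Finset (Fin 7))) :
    exactlyOne (pre A) (pre B) (pre C) = pre (exactlyOne A B C) := by
  ext x
  simp only [exactlyOne, pre, mem_union, mem_sdiff, mem_filter, mem_univ, true_and, not_or]

/-- `f^{-1}` commutes with unions. [cite: WilliamsKK2025, §4 (p. 4)] -/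
theorem pre_union (A B : Finset (Finset (Fin 7))) : pre (A ∪ B) = pre A ∪ pre B := by
  ext x; simp [pre, mem_union]

/-- `f^{-1}` commutes with intersections. [cite: WilliamsKK2025, §4 (p. 4)] -/
theorem pre_inter (A B : Finset (Finset (Fin 7))) : pre (A ∩ B) = pre A ∩ pre B := by
  ext x; simp [pre, mem_inter]

/-- `|Q_21| = 8^7 = 2^21` ("a counterexample in `n = 21` dimensions" presented as `(Q_3)^7`). [cite: WilliamsKK2025, §4 (p. 4)] -/
theorem card_cube21 : Fintype.card Cube21 = 2 ^ 21 := by simp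

/-! ### The printed systems in `Q_7(3/8)` (`n = 7`, `l = 3`, `p = 3/8`; indices `0`-based) -/

/-- `X` = the sets containing `1` (here `0`). [cite: WilliamsKK2025, §4 (p. 4)] -/
def X7 : Finset (Finset (Fin 7)) := univ.filter fun S => (0 : Fin 7) ∈ S

/-- `Y` = the sets containing `2` (here `1`). [cite: WilliamsKK2025, §4 (p. 4)] -/
def Y7 : Finset (Finset (Fin 7)) := univ.filter fun S => (1 : Fin 7) ∈ S

/-- `Z` = "the sets of size at least `l + 1`, as well as the sets of size `l` that are not in `X` or `Y`", `l = 3`.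
[cite: WilliamsKK2025, §4 (p. 4)] -/
def Z7 : Finset (Finset (Fin 7)) :=
  univ.filter fun S => 4 ≤ #S ∨ (#S = 3 ∧ (0 : Fin 7) ∉ S ∧ (1 : Fin 7) ∉ S)

/-- The supersets of `{1, 2}` (here `{0, 1}`), i.e. `X ∩ Y` — the sets that may be added to `Z`.
[cite: WilliamsKK2025, §4 (p. 4)] -/
def U7 : Finset (Finset (Fin 7)) := univ.filter fun S => (0 : Fin 7) ∈ S ∧ (1 : Fin 7) ∈ S

/-- The supersets of `{1,2}` are exactly `X ∩ Y` ("including all the supersets of `{1, 2}` from `X ∩ Y`").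
[cite: WilliamsKK2025, §4 (p. 4)] -/
theorem U7_eq : U7 = X7 ∩ Y7 := by
  ext S; simp [U7, X7, Y7]

/-- `X` is upward closed. [cite: WilliamsKK2025, §4 (p. 4)] -/
theorem isUpperSet_X7 : IsUpperSet (X7 : Set (Finset (Fin 7))) := by
  intro S T hST hS
  rw [mem_coe] at hS ⊢
  simp only [X7, mem_filter, mem_univ, true_and] at hS ⊢
  exact hST hS

/-- `Y` is upward closed. [cite: WilliamsKK2025, §4 (p. 4)] -/
theorem isUpperSet_Y7 : IsUpperSet (Y7 : Set (Finset (Fin 7))) := by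
  intro S T hST hS
  rw [mem_coe] at hS ⊢
  simp only [Y7, mem_filter, mem_univ, true_and] at hS ⊢
  exact hST hS

/-- `Z` is upward closed (a proper superset of a `3`-set has `≥ 4` elements). [cite: WilliamsKK2025, §4 (p. 4)] -/
theorem isUpperSet_Z7 : IsUpperSet (Z7 : Set (Finset (Fin 7))) := by
  intro S T hST hS
  rw [mem_coe] at hS ⊢
  simp only [Z7, mem_filter, mem_univ, true_and] at hS ⊢
  have hST' : S ⊆ T := hST
  rcases eq_or_ne S T with rfl | hne
  · exact hS
  · have hlt : #S < #T := card_lt_card (Finset.ssubset_iff_subset_ne.2 ⟨hST', hne⟩)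
    left
    rcases hS with h | ⟨h, -, -⟩ <;> omega

/-- `Z ∪ ↑{1,2}` is upward closed. [cite: WilliamsKK2025, §4 (p. 4)] -/
theorem isUpperSet_Z7_union_U7 : IsUpperSet ((Z7 ∪ U7 : Finset _) : Set (Finset (Fin 7))) := by
  rw [coe_union, U7_eq, coe_inter]
  exact isUpperSet_Z7.union (isUpperSet_X7.inter isUpperSet_Y7)

/-- The "exactly one" family of `X, Y, Z` in `Q_7`, written out as one filter (no `Finset` equality tests, so that
the weighted count below is a cheap kernel computation). [cite: WilliamsKK2025, §4 (p. 4)] -/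
def S7 : Finset (Finset (Fin 7)) :=
  univ.filter fun S =>
    ((0 : Fin 7) ∈ S ∧ (1 : Fin 7) ∉ S ∧ ¬ (4 ≤ #S ∨ (#S = 3 ∧ (0 : Fin 7) ∉ S ∧ (1 : Fin 7) ∉ S))) ∨
    ((1 : Fin 7) ∈ S ∧ (0 : Fin 7) ∉ S ∧ ¬ (4 ≤ #S ∨ (#S = 3 ∧ (0 : Fin 7) ∉ S ∧ (1 : Fin 7) ∉ S))) ∨
    ((4 ≤ #S ∨ (#S = 3 ∧ (0 : Fin 7) ∉ S ∧ (1 : Fin 7) ∉ S)) ∧ (0 : Fin 7) ∉ S ∧ (1 : Fin 7) ∉ S)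

/-- The "exactly one" family of the printed `X, Y, Z ⊂ Q_7` is the filter `S7`. [cite: WilliamsKK2025, §4 (p. 4)] -/
theorem exactlyOne_X7_Y7_Z7 : exactlyOne X7 Y7 Z7 = S7 := by
  ext S
  simp only [exactlyOne, X7, Y7, Z7, S7, mem_union, mem_sdiff, mem_filter, mem_univ, true_and, not_or]
  tauto

/-- The enlarged family `Z ∪ ↑{1,2}` ("`f^{-1}(Z)` can be modified by including sets that map to a superset of
`{1, 2}`"), written out as one filter. [cite: WilliamsKK2025, §4 (p. 4)] -/
def C7 : Finset (Finset (Fin 7)) :=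
  univ.filter fun S => (4 ≤ #S ∨ (#S = 3 ∧ (0 : Fin 7) ∉ S ∧ (1 : Fin 7) ∉ S)) ∨ ((0 : Fin 7) ∈ S ∧ (1 : Fin 7) ∈ S)

/-- `Z ∪ ↑{1,2}` is the filter `C7`. [cite: WilliamsKK2025, §4 (p. 4)] -/
theorem Z7_union_U7 : Z7 ∪ U7 = C7 := by
  ext S
  simp only [Z7, U7, C7, mem_union, mem_filter, mem_univ, true_and]

/-- `μ_{3/8}(X) = μ_{3/8}(Y) = 3/8` exactly: `8^7·μ = 786432 = 3·8^6`. [cite: WilliamsKK2025, §4 (p. 4)] -/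
theorem wt_X7 : wt X7 = 786432 := by decide

/-- `8^7·μ_{3/8}(Y) = 786432 = (3/8)·8^7`. [cite: WilliamsKK2025, §4 (p. 4)] -/
theorem wt_Y7 : wt Y7 = 786432 := by decide

/-- "There, the measure of `Z` is only `≈ 0.323`": `8^7·μ(Z) = 678402` (`678402/2097152 = 0.32349…`).
[cite: WilliamsKK2025, §4 (p. 4)] -/
theorem wt_Z7 : wt Z7 = 678402 := by decide

/-- "including all the supersets of `{1, 2}` from `X ∩ Y` boosts the measure of `Z` up to `≈ 0.377 > 3/8`":
`8^7·μ(Z ∪ ↑{1,2}) = 790902` (`790902/2097152 = 0.37713… > 0.375`). [cite: WilliamsKK2025, §4 (p. 4)] -/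
theorem wt_C7 : wt C7 = 790902 := by decide

/-- "`q(p) > 0.447` if `p = 3/8`" (`n = 7`, `l = 3`): `8^7·μ(S_1) = 937950` (`937950/2097152 = 0.44725… > 4/9 = 0.4444…`).
[cite: WilliamsKK2025, §4 (p. 4)] -/
theorem wt_S7 : wt S7 = 937950 := by decide

/-- The three printed decimals, exactly. [cite: WilliamsKK2025, §4 (p. 4)] -/
theorem printed_decimals :
    (0.323 : ℝ) < 678402 / 8 ^ 7 ∧ (678402 : ℝ) / 8 ^ 7 < 0.324 ∧
    (3 / 8 : ℝ) < 790902 / 8 ^ 7 ∧ (790902 : ℝ) / 8 ^ 7 < 0.378 ∧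
    (0.447 : ℝ) < 937950 / 8 ^ 7 ∧ (4 / 9 : ℝ) < 937950 / 8 ^ 7 := by
  norm_num

/-! ### The counterexample in `Q_21` -/

/-- **Williams 2025, §4 — the counterexample, in the block presentation `Q_21 ≅ (Q_3)^7`.**  There are upward closed
`X, Y, Z ⊂ Q_21` with `|X| = |Y| = |Z| = 786432 = (3/8)·2^21` whose "exactly one" set has
`|S_1| = 937950 > (4/9)·2^21`: `X = f^{-1}(X_7)`, `Y = f^{-1}(Y_7)`, and `Z` between `f^{-1}(Z_7)` and
`f^{-1}(Z_7 ∪ ↑{1,2})` obtained by adding maximal sets one at a time. [cite: WilliamsKK2025, §4 (pp. 3–4)] -/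
theorem conjecture4_false_cube21 :
    ∃ X Y Z : Finset Cube21, IsUpperSet (X : Set Cube21) ∧ IsUpperSet (Y : Set Cube21) ∧
      IsUpperSet (Z : Set Cube21) ∧ #X = 786432 ∧ #Y = 786432 ∧ #Z = 786432 ∧
      #(exactlyOne X Y Z) = 937950 := by
  obtain ⟨Z, hZ, hZU, hZC, hZcard⟩ := exists_isUpperSet_between (U := pre Z7) (C := pre (Z7 ∪ U7))
    (m := 786432) (isUpperSet_pre isUpperSet_Z7) (isUpperSet_pre isUpperSet_Z7_union_U7)
    (pre_mono subset_union_left) (by rw [card_pre, wt_Z7]; norm_num)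
    (by rw [card_pre, Z7_union_U7, wt_C7]; norm_num)
  refine ⟨pre X7, pre Y7, Z, isUpperSet_pre isUpperSet_X7, isUpperSet_pre isUpperSet_Y7, hZ,
    by rw [card_pre, wt_X7], by rw [card_pre, wt_Y7], hZcard, ?_⟩
  rw [exactlyOne_eq_of_subset hZU (by rwa [pre_union, U7_eq, pre_inter] at hZC), exactlyOne_pre, card_pre,
    exactlyOne_X7_Y7_Z7, wt_S7]

/-! ### Transport to `Q_21 = 2^{[21]}` -/

/-- The coordinate bijection `[7] × [3] ≃ [21]`, `(i, j) ↦ 3i + j` (`finProdFinEquiv`). [folklore] -/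
def e21 : Fin 7 × Fin 3 ≃ Fin 21 := finProdFinEquiv

/-- The order isomorphism `(Q_3)^7 ≃o Q_21` ("Viewing `Q_21 ≅ (Q_3)^7`"). [cite: WilliamsKK2025, §4 (p. 4)] -/
def cubeIso : Cube21 ≃o Finset (Fin 21) where
  toFun x := univ.filter fun k => (e21.symm k).2 ∈ x (e21.symm k).1
  invFun T := fun i => univ.filter fun j => e21 (i, j) ∈ T
  left_inv x := by
    ext i j
    simp
  right_inv T := by
    ext k
    simp only [mem_filter, mem_univ, true_and, Prod.mk.eta, Equiv.apply_symm_apply]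
  map_rel_iff' := by
    intro x y
    simp only [Equiv.coe_fn_mk, subset_iff, mem_filter, mem_univ, true_and]
    constructor
    · intro h i j hj
      have := @h (e21 (i, j))
      simp only [Equiv.symm_apply_apply] at this
      exact this hj
    · intro h k hk
      exact h _ hk

/-- `exactlyOne` commutes with injective images. [folklore] -/
private theorem exactlyOne_map {α β : Type*} [DecidableEq α] [DecidableEq β] (g : α ↪ β) (X Y Z : Finset α) :
    exactlyOne (X.map g) (Y.map g) (Z.map g) = (exactlyOne X Y Z).map g := by
  simp only [exactlyOne, map_union, map_sdiff]

/-- **Williams 2025, §4: Kahn's Conjecture 4 is false — the counterexample in `Q_21`.**  There are upward closed set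
systems `X, Y, Z ⊂ Q_21 = 2^{[21]}` with `|X| = |Y| = |Z|` (`= 786432 = (3/8)·2^21`) such that the family `S_1` of
sets lying in exactly one of them has `|S_1|/2^21 = 937950/2097152 = 0.44725… > 4/9`.
[cite: WilliamsKK2025, §4 (pp. 3–4); Conjecture 4 (p. 2)] -/
theorem _root_.Literature.Probability.LatticeModels.williams2025_conjecture4_false :
    ∃ X Y Z : Finset (Finset (Fin 21)), IsUpperSet (X : Set (Finset (Fin 21))) ∧
      IsUpperSet (Y : Set (Finset (Fin 21))) ∧ IsUpperSet (Z : Set (Finset (Fin 21))) ∧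
      #X = #Y ∧ #Y = #Z ∧ #X = 786432 ∧ #(exactlyOne X Y Z) = 937950 ∧
      (4 / 9 : ℝ) < (#(exactlyOne X Y Z) : ℝ) / 2 ^ 21 := by
  obtain ⟨X, Y, Z, hX, hY, hZ, hXc, hYc, hZc, hS⟩ := conjecture4_false_cube21
  let g : Cube21 ↪ Finset (Fin 21) := cubeIso.toEquiv.toEmbedding
  have hup : ∀ {W : Finset Cube21}, IsUpperSet (W : Set Cube21) →
      IsUpperSet ((W.map g : Finset _) : Set (Finset (Fin 21))) := fun {W} hW => by
    rw [coe_map]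
    exact hW.image cubeIso
  refine ⟨X.map g, Y.map g, Z.map g, hup hX, hup hY, hup hZ, ?_, ?_, ?_, ?_, ?_⟩
  · rw [card_map, card_map, hXc, hYc]
  · rw [card_map, card_map, hYc, hZc]
  · rw [card_map, hXc]
  · rw [exactlyOne_map, card_map, hS]
  · rw [exactlyOne_map, card_map, hS]
    norm_num

/-- **Kahn's Conjecture 4 ("If `|X| = |Y| = |Z|`, then `|S_1|/2^n ≤ 4/9`", for upward closed `X, Y, Z ⊂ Q_n`) is
false**, as displayed: its negation over all dimensions `n`, witnessed at `n = 21`.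
[cite: WilliamsKK2025, Conjecture 4 (p. 2) and §4 (pp. 3–4)] -/
theorem _root_.Literature.Probability.LatticeModels.kahn_conjecture4_false :
    ¬ ∀ (n : ℕ) (X Y Z : Finset (Finset (Fin n))), IsUpperSet (X : Set (Finset (Fin n))) →
      IsUpperSet (Y : Set (Finset (Fin n))) → IsUpperSet (Z : Set (Finset (Fin n))) →
      #X = #Y → #Y = #Z → (#(exactlyOne X Y Z) : ℝ) / 2 ^ n ≤ 4 / 9 := by
  intro h
  obtain ⟨X, Y, Z, hX, hY, hZ, hXY, hYZ, -, -, hlt⟩ := williams2025_conjecture4_false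
  exact absurd (h 21 X Y Z hX hY hZ hXY hYZ) (not_le.2 hlt)

end Williams2025

end Literature.Probability.LatticeModels
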